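import Literature.Geometry.Riemannian.PieceMetricLocalExtension
import Literature.Geometry.Riemannian.PieceMetricNhd
import Literature.Geometry.Riemannian.RiemannianMetricExists
import Mathlib.Geometry.Manifold.PartitionOfUnity
import HarnessLib

/-!
# A Riemannian metric on the glued manifold extending the metric of a piece (Lee 2018, Ex. 6.44)

Topic `Literature/Geometry/Riemannian` (namespace `Literature.Geometry.Riemannian`). Conclusion
of layer L1-(i) of the proof programme of `Literature.Geometry.Riemannian.BaerHankePscGluing`:
for an equidimensional `C^∞` embedding `jA : A ↪ X` of a COMPACT manifold with boundary `A`
(boundary datum `b_A`) into a compact boundaryless manifold `X`, every Riemannian `C^∞` metric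
`g_A` on `A` is induced by a Riemannian `C^∞` metric on the whole of `X`:

  `∃ ĝ` Riemannian on `X` with `ĝ_{jA a}(d(jA) v, d(jA) w) = g_A(v, w)` for all `a, v, w`
  (`exists_riemannianMetric_pullback_eq`).

This is the step "extend the metric smoothly to `M̃`" of Lee 2018, Example 6.44 (boundary normal
coordinates), with the glued manifold `X ⊇ jA(A)` in place of the double. Proof (Lee 2013,
Lemma 8.6 / Prop. 13.3 pattern):
1. the local symmetric extensions of `PieceMetricLocalExtension.lean` (interior points:
   `(jA⁻¹)^* g_A`; seam points: Seeley extension in a seam chart) and the zero field off the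
   closed set `jA(A)` are glued by a smooth partition of unity under the CONVEX fibrewise
   constraint "symmetric, and equal to `(jA)_* g_A` over `jA(A)`"
   (Mathlib's `exists_contMDiffSection_forall_mem_convex_of_local`) — a global `C^∞` symmetric
   field `s` with `jA^* s = g_A`;
2. `s` is positive definite on `jA(A)` (`posDef_of_pullback_eq`), hence on an open `W ⊇ jA(A)`
   (`isOpen_setOf_posDef_section`);
3. with a background Riemannian metric `h` (`exists_isRiemannian`) and a smooth bump `f`,
   `f = 1` on `jA(A)`, `f = 0` off `W`, `0 ≤ f ≤ 1` (`exists_contMDiffMap_zero_one_of_isClosed`),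
   the field `ĝ = f s + (1 - f) h` is `C^∞`, symmetric, positive definite everywhere, and equal
   to `s` over `jA(A)`.

No definitions, no named facts (D-0026).

## References

* J. M. Lee, *Introduction to Riemannian Manifolds*, 2nd ed., GTM 176 (2018), Example 6.44;
  Prop. 2.4. [LeeRiemannianManifolds2018]
* J. M. Lee, *Introduction to Smooth Manifolds*, 2nd ed. (2013), Lemma 8.6, Prop. 13.3.
  [LeeSmoothManifolds2013]
-/

noncomputable section

open Bundle Set Function Filter
open scoped Manifold ContDiff Topology

-- see `PieceMetricLocalExtension.lean`: Mathlib's simplex-category `Fintype` instance breaks the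
-- nested synthesis of `NormedAddCommGroup (ℝᵏ⁺² →L[ℝ] ℝᵏ⁺² →L[ℝ] ℝ)`; it is irrelevant here.
attribute [-instance] SimplexCategory.instFintypeToTypeOrderHomFinHAddNatLenOfNat

namespace Literature.Geometry.Riemannian

open Literature.Geometry.Lorentzian Literature.Geometry.Lorentzian.PseudoRiemannianMetric
  Literature.Geometry.Manifold Literature.Topology.FourManifolds

universe u

variable {k : ℕ} {A : Type u} [TopologicalSpace A] [ChartedSpace (EuclideanHalfSpace (k + 2)) A]
  [IsManifold (𝓡∂ (k + 2)) ∞ A]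
  {X : Type u} [TopologicalSpace X] [ChartedSpace (EuclideanSpace ℝ (Fin (k + 2))) X]
  {jA : A → X}

/-- The fibrewise constraint "symmetric and equal to `(jA)_* g_A` over `jA(A)`" is convex.
[folklore] -/
theorem convex_setOf_symm_pullback_eq
    (gA : PseudoRiemannianMetric (𝓡∂ (k + 2)) ∞ (EuclideanSpace ℝ (Fin (k + 2)))
      (TangentSpace (𝓡∂ (k + 2)) : A → Type _)) (p : X) :
    Convex ℝ {B : TangentSpace (𝓡 (k + 2)) p →L[ℝ] TangentSpace (𝓡 (k + 2)) p →L[ℝ] ℝ |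
      (∀ v w, B v w = B w v) ∧
        ∀ a : A, jA a = p → ∀ v w : TangentSpace (𝓡∂ (k + 2)) a,
          B (mfderiv (𝓡∂ (k + 2)) (𝓡 (k + 2)) jA a v) (mfderiv (𝓡∂ (k + 2)) (𝓡 (k + 2)) jA a w) =
            gA.val a v w} := by
  rintro B₁ ⟨h1s, h1v⟩ B₂ ⟨h2s, h2v⟩ c d hc hd hcd
  refine ⟨fun v w ↦ ?_, fun a ha v w ↦ ?_⟩
  · simp [h1s v w, h2s v w]
  · change c * B₁ _ _ + d * B₂ _ _ = _
    rw [h1v a ha v w, h2v a ha v w, ← add_mul, hcd, one_mul]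

variable [IsManifold (𝓡 (k + 2)) ∞ X] [T2Space X] [CompactSpace X] [CompactSpace A] [Nonempty A]

set_option synthInstance.maxHeartbeats 400000 in
set_option maxHeartbeats 800000 in
/-- **A global `C^∞` symmetric field on `X` inducing `g_A` on the piece** (step 1): partition of
unity gluing (`exists_contMDiffSection_forall_mem_convex_of_local`) of the local extensions of
`PieceMetricLocalExtension.exists_localExtension` near `jA(A)` and of the zero field off the
closed set `jA(A)` (`A` compact, `X` Hausdorff). [cite: LeeRiemannianManifolds2018, Example 6.44] -/
theorem exists_symmField_pullback_eq
    (hjA : Manifold.IsSmoothEmbedding (𝓡∂ (k + 2)) (𝓡 (k + 2)) ∞ jA)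
    (gA : PseudoRiemannianMetric (𝓡∂ (k + 2)) ∞ (EuclideanSpace ℝ (Fin (k + 2)))
      (TangentSpace (𝓡∂ (k + 2)) : A → Type _))
    (bA : BoundaryData (𝓡∂ (k + 2)) A (𝓡 (k + 1))) :
    ∃ s : Π p : X, TangentSpace (𝓡 (k + 2)) p →L[ℝ] TangentSpace (𝓡 (k + 2)) p →L[ℝ] ℝ,
      ContMDiff (𝓡 (k + 2)) ((𝓡 (k + 2)).prod 𝓘(ℝ, EuclideanSpace ℝ (Fin (k + 2)) →L[ℝ]
          EuclideanSpace ℝ (Fin (k + 2)) →L[ℝ] ℝ)) ∞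
        (fun p : X ↦ TotalSpace.mk' (EuclideanSpace ℝ (Fin (k + 2)) →L[ℝ]
            EuclideanSpace ℝ (Fin (k + 2)) →L[ℝ] ℝ)
          (E := fun p : X ↦ TangentSpace (𝓡 (k + 2)) p →L[ℝ] TangentSpace (𝓡 (k + 2)) p →L[ℝ] ℝ)
          p (s p)) ∧
      (∀ (p : X) (v w : TangentSpace (𝓡 (k + 2)) p), s p v w = s p w v) ∧
      ∀ (a : A) (v w : TangentSpace (𝓡∂ (k + 2)) a),
        s (jA a) (mfderiv (𝓡∂ (k + 2)) (𝓡 (k + 2)) jA a v)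
          (mfderiv (𝓡∂ (k + 2)) (𝓡 (k + 2)) jA a w) = gA.val a v w := by
  have hclosed : IsClosed (range jA) := (isCompact_range hjA.contMDiff.continuous).isClosed
  -- the convex constraint
  set t : Π p : X, Set (TangentSpace (𝓡 (k + 2)) p →L[ℝ] TangentSpace (𝓡 (k + 2)) p →L[ℝ] ℝ) :=
    fun p ↦ {B | (∀ v w, B v w = B w v) ∧
      ∀ a : A, jA a = p → ∀ v w : TangentSpace (𝓡∂ (k + 2)) a,
        B (mfderiv (𝓡∂ (k + 2)) (𝓡 (k + 2)) jA a v)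
          (mfderiv (𝓡∂ (k + 2)) (𝓡 (k + 2)) jA a w) = gA.val a v w} with ht
  have htc : ∀ p, Convex ℝ (t p) := fun p ↦ convex_setOf_symm_pullback_eq gA p
  -- local sections
  have hloc : ∀ p₀ : X, ∃ U ∈ 𝓝 p₀,
      ∃ sU : Π p : X, TangentSpace (𝓡 (k + 2)) p →L[ℝ] TangentSpace (𝓡 (k + 2)) p →L[ℝ] ℝ,
        ContMDiffOn (𝓡 (k + 2)) ((𝓡 (k + 2)).prod 𝓘(ℝ, EuclideanSpace ℝ (Fin (k + 2)) →L[ℝ]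
            EuclideanSpace ℝ (Fin (k + 2)) →L[ℝ] ℝ)) ∞
          (fun p : X ↦ TotalSpace.mk' (EuclideanSpace ℝ (Fin (k + 2)) →L[ℝ]
              EuclideanSpace ℝ (Fin (k + 2)) →L[ℝ] ℝ)
            (E := fun p : X ↦ TangentSpace (𝓡 (k + 2)) p →L[ℝ]
              TangentSpace (𝓡 (k + 2)) p →L[ℝ] ℝ) p (sU p)) U ∧
        ∀ p ∈ U, sU p ∈ t p := by
    intro p₀
    by_cases hp₀ : p₀ ∈ range jA
    · obtain ⟨U, hU, sU, hsU, hgood⟩ := exists_localExtension hjA gA bA hp₀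
      exact ⟨U, hU, sU, hsU, fun p hp ↦ hgood p hp⟩
    · refine ⟨(range jA)ᶜ, hclosed.isOpen_compl.mem_nhds hp₀, fun p ↦ 0, ?_, fun p hp ↦ ?_⟩
      · exact (contMDiff_zeroSection (𝕜 := ℝ)
          (E := fun p : X ↦ TangentSpace (𝓡 (k + 2)) p →L[ℝ]
            TangentSpace (𝓡 (k + 2)) p →L[ℝ] ℝ)).contMDiffOn
      · refine ⟨fun v w ↦ rfl, ?_⟩
        rintro a rfl
        exact absurd (mem_range_self a) hp
  obtain ⟨s, hs⟩ := exists_contMDiffSection_forall_mem_convex_of_local (n := ⊤) (𝓡 (k + 2))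
    (fun p : X ↦ TangentSpace (𝓡 (k + 2)) p →L[ℝ] TangentSpace (𝓡 (k + 2)) p →L[ℝ] ℝ)
    t htc hloc
  exact ⟨fun p ↦ s p, s.contMDiff, fun p ↦ (hs p).1, fun a ↦ (hs (jA a)).2 a rfl⟩

set_option synthInstance.maxHeartbeats 400000 in
set_option maxHeartbeats 800000 in
/-- **Extension of the metric of a compact piece to a Riemannian metric on the whole glued
manifold** (Lee 2018, Example 6.44: "embed `M` in its double `M̃`, extend the metric smoothly
to `M̃`"; here: any compact boundaryless `X` into which the piece `A` is smoothly and
equidimensionally embedded, e.g. the glued manifold `M ∪_∂ N`). For a Riemannian `C^∞` metric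
`g_A` on `A` there is a Riemannian `C^∞` metric `ĝ` on `X` with
`ĝ_{jA a}(d(jA) v, d(jA) w) = g_A(v, w)`: the symmetric extension `s` of
`exists_symmField_pullback_eq` is positive definite over `jA(A)` (`posDef_of_pullback_eq`), hence
on an open `W ⊇ jA(A)` (`isOpen_setOf_posDef_section`), and `ĝ = f s + (1 - f) h` for a
background Riemannian metric `h` (`exists_isRiemannian`) and a smooth bump `f`
(`f = 1` on `jA(A)`, `f = 0` off `W`, `0 ≤ f ≤ 1`, `exists_contMDiffMap_zero_one_of_isClosed`).
[cite: LeeRiemannianManifolds2018, Example 6.44] -/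
theorem exists_riemannianMetric_pullback_eq
    (hjA : Manifold.IsSmoothEmbedding (𝓡∂ (k + 2)) (𝓡 (k + 2)) ∞ jA)
    (gA : PseudoRiemannianMetric (𝓡∂ (k + 2)) ∞ (EuclideanSpace ℝ (Fin (k + 2)))
      (TangentSpace (𝓡∂ (k + 2)) : A → Type _)) (hgA : gA.IsRiemannian)
    (bA : BoundaryData (𝓡∂ (k + 2)) A (𝓡 (k + 1))) :
    ∃ g : PseudoRiemannianMetric (𝓡 (k + 2)) ∞ (EuclideanSpace ℝ (Fin (k + 2)))
        (TangentSpace (𝓡 (k + 2)) : X → Type _),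
      g.IsRiemannian ∧
      ∀ (a : A) (v w : TangentSpace (𝓡∂ (k + 2)) a),
        g.val (jA a) (mfderiv (𝓡∂ (k + 2)) (𝓡 (k + 2)) jA a v)
          (mfderiv (𝓡∂ (k + 2)) (𝓡 (k + 2)) jA a w) = gA.val a v w := by
  obtain ⟨s, hs, hsymm, hpull⟩ := exists_symmField_pullback_eq hjA gA bA
  -- positivity locus
  set W : Set X := {p : X | ∀ v : TangentSpace (𝓡 (k + 2)) p, v ≠ 0 → 0 < s p v v} with hW
  have hWo : IsOpen W := isOpen_setOf_posDef_section hs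
  have hAW : range jA ⊆ W := fun p hp v hv ↦
    posDef_of_pullback_eq hjA.isImmersion gA hgA hpull hp v hv
  have hclosed : IsClosed (range jA) := (isCompact_range hjA.contMDiff.continuous).isClosed
  -- bump function and background metric
  obtain ⟨f, hf0, hf1, hf01⟩ := exists_contMDiffMap_zero_one_of_isClosed (𝓡 (k + 2)) (n := ⊤)
    hWo.isClosed_compl hclosed (disjoint_compl_left_iff.2 hAW)
  obtain ⟨h, hh⟩ := exists_isRiemannian (I := 𝓡 (k + 2)) (M := X)
  -- the blended field
  set g : Π p : X, TangentSpace (𝓡 (k + 2)) p →L[ℝ] TangentSpace (𝓡 (k + 2)) p →L[ℝ] ℝ :=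
    fun p ↦ f p • s p + (1 - f p) • h.val p with hg
  have hgs : ContMDiff (𝓡 (k + 2)) ((𝓡 (k + 2)).prod 𝓘(ℝ, EuclideanSpace ℝ (Fin (k + 2)) →L[ℝ]
      EuclideanSpace ℝ (Fin (k + 2)) →L[ℝ] ℝ)) ∞
      (fun p : X ↦ TotalSpace.mk' (EuclideanSpace ℝ (Fin (k + 2)) →L[ℝ]
          EuclideanSpace ℝ (Fin (k + 2)) →L[ℝ] ℝ)
        (E := fun p : X ↦ TangentSpace (𝓡 (k + 2)) p →L[ℝ] TangentSpace (𝓡 (k + 2)) p →L[ℝ] ℝ)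
        p (g p)) := by
    have hf : ContMDiff (𝓡 (k + 2)) 𝓘(ℝ) ∞ (fun p ↦ f p) := f.contMDiff
    have h1f : ContMDiff (𝓡 (k + 2)) 𝓘(ℝ) ∞ (fun p ↦ (1 : ℝ) - f p) := contMDiff_const.sub hf
    exact (hf.smul_section hs).add_section (h1f.smul_section h.contMDiff)
  have hgapply : ∀ (p : X) (v w : TangentSpace (𝓡 (k + 2)) p),
      g p v w = f p * s p v w + (1 - f p) * h.val p v w := fun p v w ↦ rfl
  have hgsymm : ∀ (p : X) (v w : TangentSpace (𝓡 (k + 2)) p), g p v w = g p w v := by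
    intro p v w
    rw [hgapply, hgapply, hsymm p v w, h.symm p v w]
  have hgpos : ∀ (p : X) (v : TangentSpace (𝓡 (k + 2)) p), v ≠ 0 → 0 < g p v v := by
    intro p v hv
    rw [hgapply]
    have hhp : 0 < h.val p v v := hh p v hv
    obtain ⟨hf0', hf1'⟩ := hf01 p
    by_cases hpW : p ∈ W
    · have hsp : 0 < s p v v := hpW v hv
      rcases hf1'.eq_or_lt with hfe | hfl
      · rw [hfe]
        simpa using hsp
      · nlinarith [mul_nonneg hf0' hsp.le, mul_pos (sub_pos.2 hfl) hhp]
    · have hfz : f p = 0 := hf0 hpW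
      rw [hfz]
      simpa using hhp
  have hnd : ∀ (p : X) (v : TangentSpace (𝓡 (k + 2)) p), (∀ w, g p v w = 0) → v = 0 := by
    intro p v hv
    by_contra hne
    exact (hgpos p v hne).ne' (hv v)
  refine ⟨⟨g, hgsymm, hnd, hgs⟩, fun p v hv ↦ hgpos p v hv, fun a v w ↦ ?_⟩
  show g (jA a) _ _ = _
  rw [hgapply, hf1 (mem_range_self a), hpull a v w]
  simp

end Literature.Geometry.Riemannian
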